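import Mathlib.Analysis.Convex.Combination
import Mathlib.Analysis.Convex.Function
import Mathlib.Algebra.Order.Archimedean.Real.Basic
import Mathlib.Tactic.Positivity
import Mathlib.Tactic.FieldSimp
import Mathlib.Data.Real.Basic
import Mathlib.Tactic.Linarith
import Mathlib.Order.Interval.Set.Pi
import Mathlib.LinearAlgebra.AffineSpace.AffineMap
import HarnessLib

/-!
# Weak-duality certificates over a parameter cell from PER-VERTEX duals: the pairwise covariance
# remainder (Bertsekas, *Nonlinear Programming*, Prop. 5.1.3, pointwise form)

Topic `Literature/Computation/Certificates` (joins `SharedVaryingBoxCertificate.lean`, whose vertex duals must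
SHARE the multipliers of every parameter-dependent constraint, and `LagrangianSplitBound.lean`). Written for the
Hubbard re-charter's box words (cell hubbard-algo, seat hubbard-box-eng-3: bundle format `boxdual/0` and its exact
reader `boxdual.reader`, `HOME/hubbard-box-eng-3/BOXDUAL-FORMAT.md`). Everything is PROVED; no definition, no named
fact, no number.

Setting. A family of programs indexed by a parameter `θ` in a real vector space `E`; primal points `y : Y`, an
a-priori domain `D ⊆ Y` (variable bounds), the feasible set `F θ ⊆ Y` of the program at `θ`; an objective value
`c y : E →ᵃ[ℝ] ℝ` affine in `θ`. At each vertex `v k` (`k ∈ S`) an INDEPENDENT dual certificate is given: a finite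
family of PENALTIES `π k r y : E →ᵃ[ℝ] ℝ`, affine in `θ` for fixed `y` (multiplier of vertex `k` × affinely
parametrised equality row / inequality row / PSD block), nonnegative on the feasible set of the program at the
evaluation point (`= 0` for equality rows, `≥ 0` for `κ ≥ 0` times a satisfied inequality, `≥ 0` for a PSD Gram
matrix paired with a PSD moment block), and a vertex bound `β k ≤ c y (v k) - Σ_r π k r y (v k)` for all `y ∈ D`
(what the exact `certsdp-cert/0` evaluation certifies). NOTHING is shared between vertices. At a convex combination
`θ = Σ w_k v_k` the COMBINED dual (penalties `Σ_k w_k π k r`) is again admissible, and the pointwise weak-duality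
identity reads
  `c y θ - Σ_k w_k Σ_r π k r y θ = Σ_k w_k (c y (v k) - Σ_r π k r y (v k)) + ½ Σ_k Σ_j w_k w_j Δ_{kj}(y)`,
  `Δ_{kj}(y) := Σ_r [(π k r y - π j r y)(v k) - (π k r y - π j r y)(v j)]`
— the `w`-COVARIANCE of vertex position with vertex multipliers (the first-order parts cancel because
`Σ_j w_j (v_j - θ) = 0`). Pricing `-Δ_{kj} ≤ L k j` on the a-priori domain (the reader's exact
`L_vu = Σ_{i≠norm} B_i |D_vu,i| - d_vu - D_vu,norm`) gives the cell inequality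
  `Σ_k w_k β_k - ½ Σ_k Σ_j w_k w_j L k j ≤ c y θ` for every feasible `y ∈ D` at `θ`,
and the FLOORS the reader quotes: the pairwise-Bernstein floor `m` with `2m ≤ β k + β j - L k j` for all `k, j`
(degree-2 Bernstein coefficients on the simplex; any convex weights), the exact segment floor (two vertices,
completed square), and the box form (a coordinate box lies in the convex hull of its `2^|κ|` corners).

* `sum_mul_sub_cov_le_kernel` — pure bookkeeping, no parameter space (averaging identities as hypotheses);
* `sum_mul_sub_cov_le` — at an affine combination of vertices (affinity supplies the identities);
* `le_of_pairwiseBernstein` — `2m ≤ β k + β j - L k j ∀ k j` ⇒ `m ≤ Σ w β - ½ ΣΣ w w L` for all convex `w`;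
* `le_of_pairwiseBernstein_at` — the two combined: `m ≤ c y θ` at every convex combination;
* `le_of_forall_boxVertices_pairwiseBernstein` — BOX FORM over `Set.Icc lo hi ⊆ (κ → ℝ)`;
* `segment_sub_cov_le` — two vertices, weights `(1-s, s)`: `(1-s)β₀ + sβ₁ - s(1-s)L ≤ c y θ`;
  `segment_convexFloor_le` (`0 < L`: `β₀ - (L + β₀ - β₁)²/(4L) ≤ c y θ`, completed square) and
  `segment_endpointFloor_le` (`L ≤ 0`: `min β₀ β₁ ≤ c y θ`) — the exact segment floor F0 of the reader.

It strictly contains the shared rule (`L k j` has no row part when the varying multipliers coincide) and is the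
model-free form of the tree's `t–t'–U` window theorem `…re_expect_ge_cellFloor_of_window_certificates_TT'_ineq`
(`MathematicalPhysics/QuantumLattice/BoxDualCovarianceCombination.lean`, half-range pricing of the same remainder).
What is NOT here: strong duality; multi-affine (tensor-weight-only) data; any particular relaxation.

## Mathlib / tree search

`SharedVaryingBoxCertificate.lean`: `affineMap_apply_sum_smul` (re-proved here as a private lemma to keep the two
files independent), `le_of_forall_boxVertices_sharedVarying` (its convex-hull-of-corners step is repeated verbatim).
Mathlib: `Finset.mem_convexHull`, `Finset.centerMass_eq_of_sum_1`, `convexHull_pi`, `convexHull_pair`,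
`segment_eq_Icc'`, `AffineMap.decomp`, `Finset.sum_comm`, `Finset.sum_mul_sum`.

## References

* D. P. Bertsekas, *Nonlinear Programming*, 2nd ed., Athena Scientific, 1999, §5.1.2 Prop. 5.1.3 (Weak Duality
  Theorem, pointwise proof). [cite: Bertsekas1999NonlinearProgramming, Prop. 5.1.3]
* R. T. Rockafellar, *Convex Analysis*, Princeton 1970, §32 Thm 32.2 (extrema over convex hulls of finite sets).
  [cite: Rockafellar1970, Thm 32.2]
* S. Boyd, L. Vandenberghe, *Convex Optimization*, CUP 2004, §5.6.1 (perturbation and sensitivity of the optimal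
  value). [cite: BoydVandenberghe2004, §5.6.1]
* J. Garloff, *Convergent bounds for the range of multivariate polynomials*, Interval Mathematics 1985, LNCS 212
  (1986) 37–56, §2 (range enclosure by Bernstein coefficients). [cite: Garloff1986, §2]
-/

namespace Literature.Computation.Certificates.CovarianceBox

open Finset

variable {E : Type*} [AddCommGroup E] [Module ℝ E]

/-- A real affine map evaluated at an affine combination (`∑ w = 1`):
`f (Σ_k w_k • v_k) = Σ_k w_k f(v_k)`. [cite: Rockafellar1970, Thm 32.2] -/
private theorem affineMap_apply_sum_smul' {ι : Type*} (S : Finset ι) (w : ι → ℝ)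
    (hw1 : ∑ k ∈ S, w k = 1) (v : ι → E) (f : E →ᵃ[ℝ] ℝ) :
    f (∑ k ∈ S, w k • v k) = ∑ k ∈ S, w k * f (v k) := by
  have h : ∀ x, f x = f.linear x + f 0 := fun x => by
    have := congrFun f.decomp x
    simpa using this
  calc f (∑ k ∈ S, w k • v k) = f.linear (∑ k ∈ S, w k • v k) + f 0 := h _
    _ = ∑ k ∈ S, w k * f.linear (v k) + (∑ k ∈ S, w k) * f 0 := by
        rw [map_sum, hw1, one_mul]
        simp_rw [map_smul, smul_eq_mul]
    _ = ∑ k ∈ S, w k * f (v k) := by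
        rw [Finset.sum_mul, ← Finset.sum_add_distrib]
        refine Finset.sum_congr rfl fun k _ => ?_
        rw [h (v k)]; ring

/-- **Kernel of the per-vertex rule** (weak duality, pointwise form, with the pairwise covariance remainder;
pure bookkeeping, no parameter space). Data: weights `w ≥ 0` with `Σ w = 1`; the objective at the barycentre
`cbar y` is the `w`-average of its vertex values `cv k y`; the penalties of vertex `k`'s dual evaluated AT the
barycentre, `πbar k r y`, are the `w`-averages over `j` of their values at the vertices `πv k r j y`
(`πv k r j y` = penalty `r` of dual `k` evaluated at vertex `j`) and are nonnegative on the feasible set `F`;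
vertex bounds `β k ≤ cv k y - Σ_r πv k r k y` on `D`; pairwise prices
`-L k j ≤ Σ_r (πv k r k y - πv j r k y) - Σ_r (πv k r j y - πv j r j y)` on `D`. Then every
`y ∈ F ∩ D` has `Σ_k w_k β_k - ½ Σ_k Σ_j w_k w_j L k j ≤ cbar y`.
(Bertsekas 1999, Prop. 5.1.3: `q(μ) ≤ f(x) + Σ μⱼgⱼ(x) ≤ f(x)` for feasible `x`, applied to the combined dual.)
[cite: Bertsekas1999NonlinearProgramming, Prop. 5.1.3] -/
theorem sum_mul_sub_cov_le_kernel {Y ι R : Type*} (S : Finset ι) (w : ι → ℝ)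
    (hw0 : ∀ k ∈ S, 0 ≤ w k) (hw1 : ∑ k ∈ S, w k = 1) (F D : Set Y)
    (cbar : Y → ℝ) (cv : ι → Y → ℝ) (hc : ∀ y, cbar y = ∑ k ∈ S, w k * cv k y)
    (Rs : Finset R) (πbar : ι → R → Y → ℝ) (πv : ι → R → ι → Y → ℝ)
    (hπ : ∀ k ∈ S, ∀ r ∈ Rs, ∀ y, πbar k r y = ∑ j ∈ S, w j * πv k r j y)
    (hπpos : ∀ k ∈ S, ∀ r ∈ Rs, ∀ y ∈ F, 0 ≤ πbar k r y)
    (β : ι → ℝ) (hβ : ∀ k ∈ S, ∀ y ∈ D, β k ≤ cv k y - ∑ r ∈ Rs, πv k r k y)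
    (L : ι → ι → ℝ)
    (hL : ∀ k ∈ S, ∀ j ∈ S, ∀ y ∈ D,
      -L k j ≤ (∑ r ∈ Rs, (πv k r k y - πv j r k y)) - ∑ r ∈ Rs, (πv k r j y - πv j r j y))
    {y : Y} (hyF : y ∈ F) (hyD : y ∈ D) :
    ∑ k ∈ S, w k * β k - (1 / 2) * ∑ k ∈ S, ∑ j ∈ S, w k * w j * L k j ≤ cbar y := by
  -- abbreviations: vertex Lagrangians and the position/multiplier cross terms
  set a : ι → ι → ℝ := fun k j => ∑ r ∈ Rs, (πv k r k y - πv k r j y) with ha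
  -- (1) penalties are nonnegative at the barycentre: cbar y ≥ cbar y - Σ_k w_k Σ_r πbar k r y
  have h1 : 0 ≤ ∑ k ∈ S, w k * ∑ r ∈ Rs, πbar k r y :=
    Finset.sum_nonneg fun k hk => mul_nonneg (hw0 k hk) (Finset.sum_nonneg fun r hr => hπpos k hk r hr y hyF)
  -- (2) rewrite Σ_k w_k Σ_r πbar k r y = Σ_k w_k Σ_r πv k r k y - Σ_k Σ_j w_k w_j a k j
  have h2 : ∑ k ∈ S, w k * ∑ r ∈ Rs, πbar k r y =
      ∑ k ∈ S, w k * ∑ r ∈ Rs, πv k r k y - ∑ k ∈ S, ∑ j ∈ S, w k * w j * a k j := by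
    have e1 : ∀ k ∈ S, w k * ∑ r ∈ Rs, πbar k r y = ∑ j ∈ S, w k * w j * ∑ r ∈ Rs, πv k r j y := by
      intro k hk
      rw [Finset.sum_congr rfl fun r hr => hπ k hk r hr y, Finset.sum_comm, Finset.mul_sum]
      refine Finset.sum_congr rfl fun j _ => ?_
      rw [Finset.mul_sum, Finset.mul_sum]
      refine Finset.sum_congr rfl fun r _ => by ring
    have e2 : ∀ k ∈ S, w k * ∑ r ∈ Rs, πv k r k y = ∑ j ∈ S, w k * w j * ∑ r ∈ Rs, πv k r k y := by
      intro k _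
      rw [← Finset.sum_mul, ← Finset.mul_sum, hw1]; ring
    rw [Finset.sum_congr rfl e1, Finset.sum_congr rfl e2, ← Finset.sum_sub_distrib]
    refine Finset.sum_congr rfl fun k _ => ?_
    rw [← Finset.sum_sub_distrib]
    refine Finset.sum_congr rfl fun j _ => ?_
    rw [ha]
    simp only
    rw [Finset.sum_sub_distrib]; ring
  -- (3) symmetrisation: 2 Σ_k Σ_j w_k w_j a k j = Σ_k Σ_j w_k w_j (a k j + a j k) ≥ -Σ_k Σ_j w_k w_j L k j
  have h3 : ∑ k ∈ S, ∑ j ∈ S, w k * w j * a k j = ∑ k ∈ S, ∑ j ∈ S, w k * w j * a j k := by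
    rw [Finset.sum_comm]
    exact Finset.sum_congr rfl fun k _ => Finset.sum_congr rfl fun j _ => by ring
  have h4 : ∀ k ∈ S, ∀ j ∈ S, -L k j ≤ a k j + a j k := by
    intro k hk j hj
    have := hL k hk j hj y hyD
    have e : (∑ r ∈ Rs, (πv k r k y - πv j r k y)) - ∑ r ∈ Rs, (πv k r j y - πv j r j y) = a k j + a j k := by
      rw [ha]; simp only
      rw [Finset.sum_sub_distrib, Finset.sum_sub_distrib, Finset.sum_sub_distrib, Finset.sum_sub_distrib]; ring
    linarith
  have h5 : -(∑ k ∈ S, ∑ j ∈ S, w k * w j * L k j) ≤ 2 * ∑ k ∈ S, ∑ j ∈ S, w k * w j * a k j := by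
    have : 2 * ∑ k ∈ S, ∑ j ∈ S, w k * w j * a k j = ∑ k ∈ S, ∑ j ∈ S, w k * w j * (a k j + a j k) := by
      have split : ∑ k ∈ S, ∑ j ∈ S, w k * w j * (a k j + a j k) =
          ∑ k ∈ S, ∑ j ∈ S, w k * w j * a k j + ∑ k ∈ S, ∑ j ∈ S, w k * w j * a j k := by
        rw [← Finset.sum_add_distrib]
        refine Finset.sum_congr rfl fun k _ => ?_
        rw [← Finset.sum_add_distrib]
        exact Finset.sum_congr rfl fun j _ => by ring
      rw [split, ← h3, two_mul]
    rw [this, ← Finset.sum_neg_distrib]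
    refine Finset.sum_le_sum fun k hk => ?_
    rw [← Finset.sum_neg_distrib]
    refine Finset.sum_le_sum fun j hj => ?_
    have hwkj : 0 ≤ w k * w j := mul_nonneg (hw0 k hk) (hw0 j hj)
    have := mul_le_mul_of_nonneg_left (h4 k hk j hj) hwkj
    linarith
  -- (4) vertex bounds
  have h6 : ∑ k ∈ S, w k * β k ≤ ∑ k ∈ S, w k * (cv k y - ∑ r ∈ Rs, πv k r k y) :=
    Finset.sum_le_sum fun k hk => mul_le_mul_of_nonneg_left (hβ k hk y hyD) (hw0 k hk)
  have h7 : ∑ k ∈ S, w k * (cv k y - ∑ r ∈ Rs, πv k r k y) =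
      cbar y - ∑ k ∈ S, w k * ∑ r ∈ Rs, πv k r k y := by
    rw [hc y, ← Finset.sum_sub_distrib]
    exact Finset.sum_congr rfl fun k _ => by ring
  linarith

/-- **Per-vertex certificates combined at an affine combination of vertices.** Parameter space `E`; objective
`c y` and every penalty `π k r y` (dual `k`, constraint `r`) are real AFFINE maps of the parameter; weights
`w ≥ 0`, `Σ w = 1`, `θ = Σ_k w_k • v_k`. If every vertex `v k` certifies `β k` on the a-priori domain `D` with ITS
OWN dual, every penalty is nonnegative on the feasible set of the program AT `θ`, and the pairwise cross-defects
are priced on `D` by `L k j`, then every `y ∈ F θ ∩ D` has `Σ_k w_k β_k - ½ Σ_k Σ_j w_k w_j L k j ≤ c y θ`.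
[cite: Bertsekas1999NonlinearProgramming, Prop. 5.1.3] -/
theorem sum_mul_sub_cov_le {Y ι R : Type*} (S : Finset ι) (w : ι → ℝ)
    (hw0 : ∀ k ∈ S, 0 ≤ w k) (hw1 : ∑ k ∈ S, w k = 1) (v : ι → E)
    (F : E → Set Y) (D : Set Y) (c : Y → E →ᵃ[ℝ] ℝ)
    (Rs : Finset R) (π : ι → R → Y → E →ᵃ[ℝ] ℝ)
    (hπpos : ∀ k ∈ S, ∀ r ∈ Rs, ∀ y ∈ F (∑ k ∈ S, w k • v k), 0 ≤ π k r y (∑ k ∈ S, w k • v k))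
    (β : ι → ℝ) (hβ : ∀ k ∈ S, ∀ y ∈ D, β k ≤ c y (v k) - ∑ r ∈ Rs, π k r y (v k))
    (L : ι → ι → ℝ)
    (hL : ∀ k ∈ S, ∀ j ∈ S, ∀ y ∈ D,
      -L k j ≤ (∑ r ∈ Rs, (π k r y (v k) - π j r y (v k))) - ∑ r ∈ Rs, (π k r y (v j) - π j r y (v j)))
    {y : Y} (hyF : y ∈ F (∑ k ∈ S, w k • v k)) (hyD : y ∈ D) :
    ∑ k ∈ S, w k * β k - (1 / 2) * ∑ k ∈ S, ∑ j ∈ S, w k * w j * L k j ≤ c y (∑ k ∈ S, w k • v k) :=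
  sum_mul_sub_cov_le_kernel S w hw0 hw1 (F (∑ k ∈ S, w k • v k)) D
    (fun y => c y (∑ k ∈ S, w k • v k)) (fun k y => c y (v k))
    (fun y => affineMap_apply_sum_smul' S w hw1 v (c y))
    Rs (fun k r y => π k r y (∑ j ∈ S, w j • v j)) (fun k r j y => π k r y (v j))
    (fun k _ r _ y => affineMap_apply_sum_smul' S w hw1 v (π k r y)) hπpos β hβ L hL hyF hyD

/-- **Pairwise-Bernstein floor** (degree-2 Bernstein coefficients on the simplex): if
`2m ≤ β k + β j - L k j` for all `k, j ∈ S` (for `k = j` with `L k k = 0` this is `m ≤ β k`), then for every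
convex weight vector `m ≤ Σ_k w_k β_k - ½ Σ_k Σ_j w_k w_j L k j` — the range-enclosure property of
the (simplicial, degree-2) Bernstein form: a homogeneous quadratic in barycentric coordinates is bounded below
by its least Bernstein coefficient; here the coefficients are `β k` (diagonal, `L k k = 0`) and
`(β k + β j - L k j)/2`. Proof: `Σ w β - ½ ΣΣ w w L = ½ ΣΣ w_k w_j (β_k + β_j - L_kj) ≥ ½ ΣΣ w_k w_j · 2m = m`.
[cite: Garloff1986, §2 (range enclosure by Bernstein coefficients)] -/
theorem le_of_pairwiseBernstein {ι : Type*} (S : Finset ι) (w : ι → ℝ)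
    (hw0 : ∀ k ∈ S, 0 ≤ w k) (hw1 : ∑ k ∈ S, w k = 1) (β : ι → ℝ) (L : ι → ι → ℝ) (m : ℝ)
    (hm : ∀ k ∈ S, ∀ j ∈ S, 2 * m ≤ β k + β j - L k j) :
    m ≤ ∑ k ∈ S, w k * β k - (1 / 2) * ∑ k ∈ S, ∑ j ∈ S, w k * w j * L k j := by
  have e : ∑ k ∈ S, w k * β k - (1 / 2) * ∑ k ∈ S, ∑ j ∈ S, w k * w j * L k j =
      (1 / 2) * ∑ k ∈ S, ∑ j ∈ S, w k * w j * (β k + β j - L k j) := by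
    have e1 : ∑ k ∈ S, ∑ j ∈ S, w k * w j * (β k + β j - L k j) =
        ∑ k ∈ S, ∑ j ∈ S, w k * w j * β k + ∑ k ∈ S, ∑ j ∈ S, w k * w j * β j -
          ∑ k ∈ S, ∑ j ∈ S, w k * w j * L k j := by
      rw [← Finset.sum_add_distrib, ← Finset.sum_sub_distrib]
      refine Finset.sum_congr rfl fun k _ => ?_
      rw [← Finset.sum_add_distrib, ← Finset.sum_sub_distrib]
      exact Finset.sum_congr rfl fun j _ => by ring
    have e2 : ∑ k ∈ S, ∑ j ∈ S, w k * w j * β k = ∑ k ∈ S, w k * β k := by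
      refine Finset.sum_congr rfl fun k _ => ?_
      have : ∑ j ∈ S, w k * w j * β k = (w k * β k) * ∑ j ∈ S, w j := by
        rw [Finset.mul_sum]; exact Finset.sum_congr rfl fun j _ => by ring
      rw [this, hw1, mul_one]
    have e3 : ∑ k ∈ S, ∑ j ∈ S, w k * w j * β j = ∑ j ∈ S, w j * β j := by
      rw [Finset.sum_comm]
      refine Finset.sum_congr rfl fun j _ => ?_
      have : ∑ k ∈ S, w k * w j * β j = (w j * β j) * ∑ k ∈ S, w k := by
        rw [Finset.mul_sum]; exact Finset.sum_congr rfl fun k _ => by ring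
      rw [this, hw1, mul_one]
    rw [e1, e2, e3]; ring
  have h : ∑ k ∈ S, ∑ j ∈ S, w k * w j * (2 * m) ≤ ∑ k ∈ S, ∑ j ∈ S, w k * w j * (β k + β j - L k j) :=
    Finset.sum_le_sum fun k hk => Finset.sum_le_sum fun j hj =>
      mul_le_mul_of_nonneg_left (hm k hk j hj) (mul_nonneg (hw0 k hk) (hw0 j hj))
  have hsq : ∑ k ∈ S, ∑ j ∈ S, w k * w j * (2 * m) = 2 * m := by
    have : ∑ k ∈ S, ∑ j ∈ S, w k * w j * (2 * m) = (∑ k ∈ S, w k) * (∑ j ∈ S, w j) * (2 * m) := by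
      rw [Finset.sum_mul_sum, Finset.sum_mul]
      refine Finset.sum_congr rfl fun k _ => ?_
      rw [Finset.sum_mul]
    rw [this, hw1]; ring
  rw [e]; linarith

/-- **Pairwise-Bernstein floor at an affine combination**: per-vertex certificates (`β`, `L` as in
`sum_mul_sub_cov_le`) and `2m ≤ β k + β j - L k j` for all `k, j` give `m ≤ c y θ` for every `y ∈ F θ ∩ D` at
`θ = Σ w_k • v_k`. [cite: Bertsekas1999NonlinearProgramming, Prop. 5.1.3] -/
theorem le_of_pairwiseBernstein_at {Y ι R : Type*} (S : Finset ι) (w : ι → ℝ)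
    (hw0 : ∀ k ∈ S, 0 ≤ w k) (hw1 : ∑ k ∈ S, w k = 1) (v : ι → E)
    (F : E → Set Y) (D : Set Y) (c : Y → E →ᵃ[ℝ] ℝ)
    (Rs : Finset R) (π : ι → R → Y → E →ᵃ[ℝ] ℝ)
    (hπpos : ∀ k ∈ S, ∀ r ∈ Rs, ∀ y ∈ F (∑ k ∈ S, w k • v k), 0 ≤ π k r y (∑ k ∈ S, w k • v k))
    (β : ι → ℝ) (hβ : ∀ k ∈ S, ∀ y ∈ D, β k ≤ c y (v k) - ∑ r ∈ Rs, π k r y (v k))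
    (L : ι → ι → ℝ)
    (hL : ∀ k ∈ S, ∀ j ∈ S, ∀ y ∈ D,
      -L k j ≤ (∑ r ∈ Rs, (π k r y (v k) - π j r y (v k))) - ∑ r ∈ Rs, (π k r y (v j) - π j r y (v j)))
    (m : ℝ) (hm : ∀ k ∈ S, ∀ j ∈ S, 2 * m ≤ β k + β j - L k j)
    {y : Y} (hyF : y ∈ F (∑ k ∈ S, w k • v k)) (hyD : y ∈ D) :
    m ≤ c y (∑ k ∈ S, w k • v k) :=
  le_trans (le_of_pairwiseBernstein S w hw0 hw1 β L m hm)
    (sum_mul_sub_cov_le S w hw0 hw1 v F D c Rs π hπpos β hβ L hL hyF hyD)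

/-- **Box form** (the `boxdual/0` floor F1 on an affine family): per-vertex certificates at the `2^|κ|` corners
`Fintype.piFinset fun k => {lo k, hi k}` of `Set.Icc lo hi ⊆ (κ → ℝ)`, penalties affine in `θ` and nonnegative on
feasible points throughout the box, vertex bounds `β v` on the a-priori domain `D`, pairwise prices `L v u` on `D`,
and a floor `m` with `2m ≤ β v + β u - L v u` for all corner pairs, certify `m ≤ c y θ` at EVERY `θ` of the box
for every `y ∈ F θ ∩ D` (the box lies in the convex hull of its corners).
[cite: Bertsekas1999NonlinearProgramming, Prop. 5.1.3] -/
theorem le_of_forall_boxVertices_pairwiseBernstein {Y R κ : Type*} [Fintype κ] [DecidableEq κ]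
    (lo hi : κ → ℝ) (F : (κ → ℝ) → Set Y) (D : Set Y) (c : Y → (κ → ℝ) →ᵃ[ℝ] ℝ)
    (Rs : Finset R) (π : (κ → ℝ) → R → Y → (κ → ℝ) →ᵃ[ℝ] ℝ)
    (hπpos : ∀ v ∈ Fintype.piFinset (fun k => ({lo k, hi k} : Finset ℝ)), ∀ r ∈ Rs,
      ∀ θ ∈ Set.Icc lo hi, ∀ y ∈ F θ, 0 ≤ π v r y θ)
    (β : (κ → ℝ) → ℝ)
    (hβ : ∀ v ∈ Fintype.piFinset (fun k => ({lo k, hi k} : Finset ℝ)), ∀ y ∈ D,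
      β v ≤ c y v - ∑ r ∈ Rs, π v r y v)
    (L : (κ → ℝ) → (κ → ℝ) → ℝ)
    (hL : ∀ v ∈ Fintype.piFinset (fun k => ({lo k, hi k} : Finset ℝ)),
      ∀ u ∈ Fintype.piFinset (fun k => ({lo k, hi k} : Finset ℝ)), ∀ y ∈ D,
      -L v u ≤ (∑ r ∈ Rs, (π v r y v - π u r y v)) - ∑ r ∈ Rs, (π v r y u - π u r y u))
    (m : ℝ) (hm : ∀ v ∈ Fintype.piFinset (fun k => ({lo k, hi k} : Finset ℝ)),
      ∀ u ∈ Fintype.piFinset (fun k => ({lo k, hi k} : Finset ℝ)), 2 * m ≤ β v + β u - L v u)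
    {θ : κ → ℝ} (hθ : θ ∈ Set.Icc lo hi) {y : Y} (hyF : y ∈ F θ) (hyD : y ∈ D) : m ≤ c y θ := by
  classical
  set T := Fintype.piFinset (fun k => ({lo k, hi k} : Finset ℝ)) with hT
  -- the box lies in the convex hull of its corners (as in `SharedVaryingBox.le_of_forall_boxVertices_sharedVarying`)
  have hθT : θ ∈ convexHull ℝ (T : Set (κ → ℝ)) := by
    rw [hT, Fintype.coe_piFinset, convexHull_pi]
    simp only [Set.mem_pi, Set.mem_univ, true_implies, Finset.coe_insert, Finset.coe_singleton]
    intro k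
    rw [convexHull_pair, segment_eq_Icc']
    exact ⟨le_trans (min_le_left _ _) (hθ.1 k), le_trans (hθ.2 k) (le_max_right _ _)⟩
  obtain ⟨w, hw0, hw1, hcm⟩ := Finset.mem_convexHull.1 hθT
  have hθeq : ∑ v ∈ T, w v • v = θ := by
    rw [← hcm, Finset.centerMass_eq_of_sum_1 _ _ hw1]; rfl
  have key := le_of_pairwiseBernstein_at (E := κ → ℝ) T w hw0 hw1 id F D c Rs π
    (fun v hv r hr y hy => by
      rw [show (∑ k ∈ T, w k • id k) = θ from hθeq] at hy ⊢; exact hπpos v hv r hr θ hθ y hy)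
    β (fun v hv y hy => hβ v hv y hy) L (fun v hv u hu y hy => hL v hv u hu y hy) m hm
    (y := y) (by rwa [show (∑ k ∈ T, w k • id k) = θ from hθeq]) hyD
  rwa [show (∑ k ∈ T, w k • id k) = θ from hθeq] at key

/-! ### Two vertices: the exact segment floor (floor F0 of the reader) -/

/-- Segment floor, convex case: for `0 < L`, the quadratic `Q(s) = (1-s) β₀ + s β₁ - s(1-s) L` satisfies
`β₀ - (L + β₀ - β₁)² / (4L) ≤ Q(s)` for every real `s` (completed square; the reader quotes this value when the
vertex `s* = (L + β₀ - β₁)/(2L)` lies in `[0,1]`, else an endpoint value, which is `≥` it). [folklore] -/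
private theorem segmentFloor_le (β₀ β₁ L s : ℝ) (hL : 0 < L) :
    β₀ - (L + β₀ - β₁) ^ 2 / (4 * L) ≤ (1 - s) * β₀ + s * β₁ - s * (1 - s) * L := by
  have hL4 : 0 < 4 * L := by linarith
  have key : (1 - s) * β₀ + s * β₁ - s * (1 - s) * L - (β₀ - (L + β₀ - β₁) ^ 2 / (4 * L)) =
      L * (s - (L + β₀ - β₁) / (2 * L)) ^ 2 := by
    field_simp
    ring
  have : 0 ≤ L * (s - (L + β₀ - β₁) / (2 * L)) ^ 2 := mul_nonneg hL.le (sq_nonneg _)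
  linarith

/-- Segment floor, concave case: for `L ≤ 0` and `s ∈ [0,1]`, `min β₀ β₁ ≤ (1-s) β₀ + s β₁ - s(1-s) L`
(the quadratic is concave, its minimum over the segment is at an endpoint). [folklore] -/
private theorem segmentFloor_le_of_nonpos (β₀ β₁ L s : ℝ) (hL : L ≤ 0) (hs0 : 0 ≤ s) (hs1 : s ≤ 1) :
    min β₀ β₁ ≤ (1 - s) * β₀ + s * β₁ - s * (1 - s) * L := by
  have h1 : min β₀ β₁ ≤ β₀ := min_le_left _ _
  have h2 : min β₀ β₁ ≤ β₁ := min_le_right _ _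
  have h3 : 0 ≤ s * (1 - s) := mul_nonneg hs0 (by linarith)
  have h4 : 0 ≤ -(s * (1 - s) * L) := by
    have := mul_nonneg h3 (neg_nonneg.2 hL)
    linarith
  nlinarith

/-- **Two-vertex cell inequality in the parameter `s`** (weights `(1-s, s)` on the vertex pair `v₀, v₁`,
`θ = (1-s) • v₀ + s • v₁`, symmetric price `L`): every `y ∈ F θ ∩ D` has
`(1-s) β₀ + s β₁ - s(1-s) L ≤ c y θ`; combine with `segmentFloor_le` / `segmentFloor_le_of_nonpos` for the floor.
[cite: Bertsekas1999NonlinearProgramming, Prop. 5.1.3] -/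
theorem segment_sub_cov_le {Y R : Type*} (v₀ v₁ : E) (s : ℝ) (hs0 : 0 ≤ s) (hs1 : s ≤ 1)
    (F : E → Set Y) (D : Set Y) (c : Y → E →ᵃ[ℝ] ℝ)
    (Rs : Finset R) (π₀ π₁ : R → Y → E →ᵃ[ℝ] ℝ)
    (hπ₀ : ∀ r ∈ Rs, ∀ y ∈ F ((1 - s) • v₀ + s • v₁), 0 ≤ π₀ r y ((1 - s) • v₀ + s • v₁))
    (hπ₁ : ∀ r ∈ Rs, ∀ y ∈ F ((1 - s) • v₀ + s • v₁), 0 ≤ π₁ r y ((1 - s) • v₀ + s • v₁))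
    (β₀ β₁ : ℝ) (hβ₀ : ∀ y ∈ D, β₀ ≤ c y v₀ - ∑ r ∈ Rs, π₀ r y v₀)
    (hβ₁ : ∀ y ∈ D, β₁ ≤ c y v₁ - ∑ r ∈ Rs, π₁ r y v₁)
    (L : ℝ) (hL : ∀ y ∈ D,
      -L ≤ (∑ r ∈ Rs, (π₀ r y v₀ - π₁ r y v₀)) - ∑ r ∈ Rs, (π₀ r y v₁ - π₁ r y v₁))
    {y : Y} (hyF : y ∈ F ((1 - s) • v₀ + s • v₁)) (hyD : y ∈ D) :
    (1 - s) * β₀ + s * β₁ - s * (1 - s) * L ≤ c y ((1 - s) • v₀ + s • v₁) := by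
  set θ := (1 - s) • v₀ + s • v₁ with hθ
  have hab : (1 - s) + s = 1 := by ring
  -- affine maps at the two-point combination
  have haff : ∀ f : E →ᵃ[ℝ] ℝ, f θ = (1 - s) * f v₀ + s * f v₁ := fun f => by
    rw [hθ, Convex.combo_affine_apply hab]; simp [smul_eq_mul]
  -- abbreviations P k j = Σ_r π_k r y (v_j)
  set P00 := ∑ r ∈ Rs, π₀ r y v₀ with hP00
  set P01 := ∑ r ∈ Rs, π₀ r y v₁ with hP01
  set P10 := ∑ r ∈ Rs, π₁ r y v₀ with hP10
  set P11 := ∑ r ∈ Rs, π₁ r y v₁ with hP11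
  have e0 : ∑ r ∈ Rs, π₀ r y θ = (1 - s) * P00 + s * P01 := by
    rw [Finset.sum_congr rfl fun r _ => haff (π₀ r y), Finset.sum_add_distrib, ← Finset.mul_sum,
      ← Finset.mul_sum]
  have e1 : ∑ r ∈ Rs, π₁ r y θ = (1 - s) * P10 + s * P11 := by
    rw [Finset.sum_congr rfl fun r _ => haff (π₁ r y), Finset.sum_add_distrib, ← Finset.mul_sum,
      ← Finset.mul_sum]
  -- nonnegativity of the combined penalties at θ
  have hp0 : 0 ≤ ∑ r ∈ Rs, π₀ r y θ := Finset.sum_nonneg fun r hr => hπ₀ r hr y hyF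
  have hp1 : 0 ≤ ∑ r ∈ Rs, π₁ r y θ := Finset.sum_nonneg fun r hr => hπ₁ r hr y hyF
  have hs1' : 0 ≤ 1 - s := by linarith
  have hq0 : 0 ≤ (1 - s) * ∑ r ∈ Rs, π₀ r y θ := mul_nonneg hs1' hp0
  have hq1 : 0 ≤ s * ∑ r ∈ Rs, π₁ r y θ := mul_nonneg hs0 hp1
  -- vertex bounds and the pairwise price
  have hb0 := hβ₀ y hyD
  have hb1 := hβ₁ y hyD
  have hLy : -L ≤ (P00 - P10) - (P01 - P11) := by
    have := hL y hyD
    rwa [Finset.sum_sub_distrib, Finset.sum_sub_distrib] at this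
  have hss : 0 ≤ s * (1 - s) := mul_nonneg hs0 hs1'
  have hcov : s * (1 - s) * (-L) ≤ s * (1 - s) * ((P00 - P10) - (P01 - P11)) :=
    mul_le_mul_of_nonneg_left hLy hss
  -- the identity behind the covariance remainder
  have key : c y θ - (1 - s) * ∑ r ∈ Rs, π₀ r y θ - s * ∑ r ∈ Rs, π₁ r y θ =
      (1 - s) * (c y v₀ - P00) + s * (c y v₁ - P11) + s * (1 - s) * ((P00 - P10) - (P01 - P11)) := by
    rw [haff (c y), e0, e1]; ring
  nlinarith [key, hcov, hq0, hq1, hb0, hb1, mul_le_mul_of_nonneg_left hb0 hs1',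
    mul_le_mul_of_nonneg_left hb1 hs0]

/-- **Exact segment floor, convex case** (reader floor F0 with `0 < L`): under the hypotheses of
`segment_sub_cov_le`, every `y ∈ F θ ∩ D` at `θ = (1-s) • v₀ + s • v₁`, `s ∈ [0,1]`, has
`β₀ - (L + β₀ - β₁)²/(4L) ≤ c y θ` — weak duality for the combined dual, minimised in closed form over the
weight (completed square). [cite: Bertsekas1999NonlinearProgramming, Prop. 5.1.3] -/
theorem segment_convexFloor_le {Y R : Type*} (v₀ v₁ : E) (s : ℝ) (hs0 : 0 ≤ s) (hs1 : s ≤ 1)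
    (F : E → Set Y) (D : Set Y) (c : Y → E →ᵃ[ℝ] ℝ)
    (Rs : Finset R) (π₀ π₁ : R → Y → E →ᵃ[ℝ] ℝ)
    (hπ₀ : ∀ r ∈ Rs, ∀ y ∈ F ((1 - s) • v₀ + s • v₁), 0 ≤ π₀ r y ((1 - s) • v₀ + s • v₁))
    (hπ₁ : ∀ r ∈ Rs, ∀ y ∈ F ((1 - s) • v₀ + s • v₁), 0 ≤ π₁ r y ((1 - s) • v₀ + s • v₁))
    (β₀ β₁ : ℝ) (hβ₀ : ∀ y ∈ D, β₀ ≤ c y v₀ - ∑ r ∈ Rs, π₀ r y v₀)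
    (hβ₁ : ∀ y ∈ D, β₁ ≤ c y v₁ - ∑ r ∈ Rs, π₁ r y v₁)
    (L : ℝ) (hLpos : 0 < L) (hL : ∀ y ∈ D,
      -L ≤ (∑ r ∈ Rs, (π₀ r y v₀ - π₁ r y v₀)) - ∑ r ∈ Rs, (π₀ r y v₁ - π₁ r y v₁))
    {y : Y} (hyF : y ∈ F ((1 - s) • v₀ + s • v₁)) (hyD : y ∈ D) :
    β₀ - (L + β₀ - β₁) ^ 2 / (4 * L) ≤ c y ((1 - s) • v₀ + s • v₁) :=
  le_trans (segmentFloor_le β₀ β₁ L s hLpos)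
    (segment_sub_cov_le v₀ v₁ s hs0 hs1 F D c Rs π₀ π₁ hπ₀ hπ₁ β₀ β₁ hβ₀ hβ₁ L hL hyF hyD)

/-- **Exact segment floor, concave case** (reader floor F0 with `L ≤ 0`): under the hypotheses of
`segment_sub_cov_le`, every `y ∈ F θ ∩ D` at `θ = (1-s) • v₀ + s • v₁`, `s ∈ [0,1]`, has `min β₀ β₁ ≤ c y θ`
(the weight polynomial is concave, so its minimum over the segment is an endpoint value).
[cite: Bertsekas1999NonlinearProgramming, Prop. 5.1.3] -/
theorem segment_endpointFloor_le {Y R : Type*} (v₀ v₁ : E) (s : ℝ) (hs0 : 0 ≤ s) (hs1 : s ≤ 1)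
    (F : E → Set Y) (D : Set Y) (c : Y → E →ᵃ[ℝ] ℝ)
    (Rs : Finset R) (π₀ π₁ : R → Y → E →ᵃ[ℝ] ℝ)
    (hπ₀ : ∀ r ∈ Rs, ∀ y ∈ F ((1 - s) • v₀ + s • v₁), 0 ≤ π₀ r y ((1 - s) • v₀ + s • v₁))
    (hπ₁ : ∀ r ∈ Rs, ∀ y ∈ F ((1 - s) • v₀ + s • v₁), 0 ≤ π₁ r y ((1 - s) • v₀ + s • v₁))
    (β₀ β₁ : ℝ) (hβ₀ : ∀ y ∈ D, β₀ ≤ c y v₀ - ∑ r ∈ Rs, π₀ r y v₀)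
    (hβ₁ : ∀ y ∈ D, β₁ ≤ c y v₁ - ∑ r ∈ Rs, π₁ r y v₁)
    (L : ℝ) (hLnonpos : L ≤ 0) (hL : ∀ y ∈ D,
      -L ≤ (∑ r ∈ Rs, (π₀ r y v₀ - π₁ r y v₀)) - ∑ r ∈ Rs, (π₀ r y v₁ - π₁ r y v₁))
    {y : Y} (hyF : y ∈ F ((1 - s) • v₀ + s • v₁)) (hyD : y ∈ D) :
    min β₀ β₁ ≤ c y ((1 - s) • v₀ + s • v₁) :=
  le_trans (segmentFloor_le_of_nonpos β₀ β₁ L s hLnonpos hs0 hs1)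
    (segment_sub_cov_le v₀ v₁ s hs0 hs1 F D c Rs π₀ π₁ hπ₀ hπ₁ β₀ β₁ hβ₀ hβ₁ L hL hyF hyD)

end Literature.Computation.Certificates.CovarianceBox
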